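import Summits.HodgeConjecture.HodgeConjecture.Theorems.SignSymmetricPowersFourFactsMono
import Literature.AlgebraicGeometry.HodgeTheory.A3PencilCircleTransportNotUnipotent
import Summits.HodgeConjecture.HodgeConjecture.Theorems.SignSymmetricPowersSignThreefoldPowersHodge
import Summits.HodgeConjecture.HodgeConjecture.Theorems.SmoothHypersurfaceGeometricGenus
import HarnessLib

/-!
# Line `andre-zariski`, skeleton **v26** (prover seat hodge-nonav-19716-p2 g11, 2026-08-29) —
# crux K1-B `SignSymmetricPowers.VeryGeneralSignCommutatorsInHg` (stmt-HodgeConjecture-19716)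

**v26 = v25k with hN′ DISCHARGED.**  v25k = {stub_cdkCover, stub_a3NonCommOdd} (hN keyed to the consumed instance: odd `n`,
monomial even direction `g₀ = c·xᵢ^d`; crux write eba517394f8c).  The A₃ port (prover-Bx g16: normal-form chart B4a p690170 ∕
p690558, shell submersion B4b, S1 p686262, FINAL GLUE H-A3NU; seat 20241-p1 g19: weighted-pencil isotopy bricks B4c; littype g22:
figure-eight homotopy p686330) made H-A3NU(f₁, g₀) a THEOREM, and the junction
`Literature.AlgebraicGeometry.HodgeTheory.symmetricA3NonCommutation_mono_of_forall_circleTransport_not_unipotent` (this seat, g10,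
p688423) turns it into the keyed binder in ONE application:
`Literature.AlgebraicGeometry.HodgeTheory.WeightedPencil.symmetricA3NonCommutation_mono_holds` (seat 20241-p1 g19, p691969: the
Literature-side A₃ port ending in this seat's junction p688423) IS the registered stub's statement, character for character (a
Summits restatement under the stub's name is refused by the gate as `dedup.landed`; the landed composition is
`Theorems.SignSymmetricPowersStubA3NonCommOdd.veryGeneralSignCommutatorsInHg_of_cdkCover`, p694950).  ONE binder remains:

* `stub_cdkCover` = hCDK = `cmsp_nonHodgeGenericPoints_countable_algebraic_cover` (Cattani–Deligne–Kaplan 1995; print theorem —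
  the floor of the item AS TYPED: the crux quantifies over VERY GENERAL forms = off countably many proper Zariski-closed subsets).

COMPOSITION = `SignSymmetricPowersFourFactsMono.veryGeneralSignCommutatorsInHg_of_genusBound_three_facts_mono stub_genusBoundThreefold hCDK
stub_a3NonCommOdd`.  CONDITIONAL skeleton (on hCDK alone); HC ∕ HC_AV not proved; rung F-H1 not moved.
-/

set_option linter.dupNamespace false

namespace Summit.HodgeConjecture.HodgeConjecture.Cruxes.VeryGeneralSignCommutatorsInHg.AndreZariski

open Literature.AlgebraicGeometry.HodgeTheory

/-! ### The stub (ONE named fact: closes by a Literature `…_holds` theorem) and the discharged binder hN′ -/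

/-- stub hCDK (= named Literature fact, Cattani–Deligne–Kaplan 1995 Cor. 1.2, CMSP (15.7)). -/
theorem stub_cdkCover :
    Literature.AlgebraicGeometry.HodgeTheory.cmsp_nonHodgeGenericPoints_countable_algebraic_cover := by
  sorry

/-- hN′ KEYED — NO LONGER A STUB (v26): the registered statement, proved BY NAME by
`WeightedPencil.symmetricA3NonCommutation_mono_holds` (seat 20241-p1 g19, p691969; the A₃ port fed through the junction p688423). The registered signature, character for character; the composition below is v25k's with this theorem in the hN′ slot. -/
theorem a3NonCommOdd_discharged :
    ∀ (n d : ℕ) (f₁ g₀ g₂ : MvPolynomial (Fin (n + 2)) ℂ) (j k : Fin (n + 2)) (a : Fin (n + 2) → ℂˣ),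
      1 ≤ n → 1 ≤ d → Odd n → (∃ (i : Fin (n + 2)) (c : ℂ), g₀ = c • MvPolynomial.X i ^ d) →
      f₁.IsHomogeneous d → g₀.IsHomogeneous d → g₂.IsHomogeneous d → IsSymmetricA3Datum f₁ g₀ g₂ j k a →
      ∀ (εa εb : ℝ) (ψ : ℂ → ℂ), IsSymmetricA3Bifurcation f₁ g₀ g₂ j a εa εb ψ →
        ∃ εa' : ℝ, 0 < εa' ∧ εa' ≤ εa ∧ SymmetricA3NonCommutation n d f₁ g₀ g₂ ψ εa' :=
  Literature.AlgebraicGeometry.HodgeTheory.WeightedPencil.symmetricA3NonCommutation_mono_holds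

/-! ### Name-keyed aliases of the stub statements (device of the K1-A skeletons v5–v12) -/
namespace __Registered

/-- Alias keyed by the registered stub name. -/
abbrev stub_cdkCover : Prop :=
  Literature.AlgebraicGeometry.HodgeTheory.cmsp_nonHodgeGenericPoints_countable_algebraic_cover

end __Registered

/-- COMPOSITION (no sorry; v26): the ONE registered input hCDK implies the crux, concluded BY NAME — the telescope
`SignSymmetricPowersFourFactsMono.veryGeneralSignCommutatorsInHg_of_genusBound_three_facts_mono` fed the LANDED hpg3
`SmoothHypersurfaceGeometricGenus.stub_genusBoundThreefold` and the LANDED hN′ (`a3NonCommOdd_discharged` above = the registered `stub_a3NonCommOdd`, by name). -/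
theorem VeryGeneralSignCommutatorsInHg_of
    (hCDK : __Registered.stub_cdkCover) :
    Summit.HodgeConjecture.HodgeConjecture.Theses.SignSymmetricPowers.VeryGeneralSignCommutatorsInHg :=
  Summit.HodgeConjecture.HodgeConjecture.Theorems.SignSymmetricPowersFourFactsMono.veryGeneralSignCommutatorsInHg_of_genusBound_three_facts_mono
    Summit.HodgeConjecture.HodgeConjecture.Theorems.SmoothHypersurfaceGeometricGenus.stub_genusBoundThreefold @hCDK @a3NonCommOdd_discharged

/-- sanity: the composition applied to the stubs yields the crux. -/
theorem VeryGeneralSignCommutatorsInHg_holds_of_stubs :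
    Summit.HodgeConjecture.HodgeConjecture.Theses.SignSymmetricPowers.VeryGeneralSignCommutatorsInHg :=
  VeryGeneralSignCommutatorsInHg_of @stub_cdkCover

/-- sanity (rung leaf): the same inputs give the rung-F-H1 leaf `SignThreefoldPowersHodge`. -/
theorem signThreefoldPowersHodge_holds_of_stubs :
    Summit.HodgeConjecture.HodgeConjecture.Theses.SignSymmetricPowers.SignThreefoldPowersHodge :=
  Summit.HodgeConjecture.HodgeConjecture.Theorems.SignSymmetricPowersSignThreefoldPowersHodge.signThreefoldPowersHodge_of_veryGeneralSignCommutatorsInHg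
    VeryGeneralSignCommutatorsInHg_holds_of_stubs

/-- documentary (monotonicity of the registry lineage): v25's general binder hN implies the keyed hN′ (now a theorem anyway). -/
theorem a3NonCommOdd_of_general
    (h : ∀ (n d : ℕ) (f₁ g₀ g₂ : MvPolynomial (Fin (n + 2)) ℂ) (j k : Fin (n + 2)) (a : Fin (n + 2) → ℂˣ),
      1 ≤ n → 1 ≤ d → f₁.IsHomogeneous d → g₀.IsHomogeneous d → g₂.IsHomogeneous d → IsSymmetricA3Datum f₁ g₀ g₂ j k a →
      ∀ (εa εb : ℝ) (ψ : ℂ → ℂ), IsSymmetricA3Bifurcation f₁ g₀ g₂ j a εa εb ψ →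
        ∃ εa' : ℝ, 0 < εa' ∧ εa' ≤ εa ∧ SymmetricA3NonCommutation n d f₁ g₀ g₂ ψ εa') :
    ∀ (n d : ℕ) (f₁ g₀ g₂ : MvPolynomial (Fin (n + 2)) ℂ) (j k : Fin (n + 2)) (a : Fin (n + 2) → ℂˣ),
      1 ≤ n → 1 ≤ d → Odd n → (∃ (i : Fin (n + 2)) (c : ℂ), g₀ = c • MvPolynomial.X i ^ d) →
      f₁.IsHomogeneous d → g₀.IsHomogeneous d → g₂.IsHomogeneous d → IsSymmetricA3Datum f₁ g₀ g₂ j k a →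
      ∀ (εa εb : ℝ) (ψ : ℂ → ℂ), IsSymmetricA3Bifurcation f₁ g₀ g₂ j a εa εb ψ →
        ∃ εa' : ℝ, 0 < εa' ∧ εa' ≤ εa ∧ SymmetricA3NonCommutation n d f₁ g₀ g₂ ψ εa' :=
  fun n d f₁ g₀ g₂ j k a hn hd _ _ => h n d f₁ g₀ g₂ j k a hn hd

end Summit.HodgeConjecture.HodgeConjecture.Cruxes.VeryGeneralSignCommutatorsInHg.AndreZariski
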